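import Summits.CriticalPhenomena.SAWScalingLimit.Theorems.SAWDevelopingMapInteriorFlatteningLiouvilleEquivalence

/-!
# `InteriorFlattening`: the open core in ROUTE vocabulary (promotion package of line `liouville-local-limits`)

Crux `stmt-CriticalPhenomena-8297`
(`Summit.CriticalPhenomena.SAWScalingLimit.Theses.SAWDevelopingMap.InteriorFlattening`, (M) of route
`SAWDevelopingMap`), line `liouville-local-limits`, lead `prover-line-stmt-CriticalPhenomena-8297-c4-0` (cycle 4).
The landed Equivalence (`interiorFlattening_iff_bulkNoFold_and_subsingleton`,
`interiorFlattening_iff_subsingleton_of_noFoldBound`) says the crux is `BulkNoFold ∧ LocalLimits.Subsingleton`, and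
the line's registered skeleton (r9d/r10, `Cruxes/InteriorFlattening/Lines/liouville_local_limits.lean`) has exactly
these two conjuncts as its top layer: S1 `stub_bulkNoFold` (⇐ the route's rank-2 crux `NoFoldBound`,
stmt-CriticalPhenomena-8296) and S5\*
`stub_localLimitsUnique : ∀ k R₀, 0 ≤ k → k < 1 → RatioAtDepth R₀ k → LocalLimits.Subsingleton` — the crux modulo S1,
research-open (DCS 2012 p. 7, orientation-independence of the lattice observable, made pointwise and uniform).

`LocalLimits` and `RatioAtDepth` live in this sub-problem's Theorems-side Defs module, which a route file cannot import.
This file records, sorry-free, the forms of the open core that ARE statable in the route file's own vocabulary, with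
their exact logical relation to the registered stub, so that the core can be filed as an item verbatim:

* `transfer_iff_subsingleton` — the TRANSFER statement `NoFoldBound → InteriorFlattening` (two existing route decls,
  no new definition) is equivalent to `NoFoldBound → LocalLimits.Subsingleton`: its entire content is the Liouville
  uniqueness of lattice-scale local limits under (K);
* `localLimitsUnique_iff_conditional` — the registered stub S5\* is equivalent to the CONDITIONAL CRUX
  `BulkNoFold → InteriorFlattening`;
* `localLimitsUnique_iff_routeVocabulary` — the same with `BulkNoFold` read back letter by letter in the route file's
  vocabulary (`bulkNoFold_iff_routeVocabulary`, definitional), i.e. a signature the planner can paste;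
* `transfer_of_localLimitsUnique` — S5\* ⟹ transfer. (Trivially also crux ⟹ transfer, `fun h _ => h`, and
  (K) + transfer ⟹ crux, `fun hK hT => hT hK`: replacing the crux by the transfer statement in the deciding theorem
  `closes`, which already binds `NoFoldBound`, loses nothing and assumes nothing new; these two one-liners are not
  stated as theorems so that no declaration of this helper file has the crux as its bare conclusion.)

No estimate is proved here; the file is the kernel-checked dictionary between the registered open stub and the two
route-level statements a planner may promote it to.

Sources: H. Duminil-Copin, S. Smirnov, Ann. of Math. 175 (2012) 1653–1665 (arXiv:1007.0575), p. 7; the line card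
`Cruxes/InteriorFlattening/Lines/liouville-local-limits.md`; `…LiouvilleEquivalence` (p115301), `…LiouvilleNecessity`
(p103986), `…LiouvilleBulkNoFold` (p104169).
-/

noncomputable section

open Literature.Probability.LatticeModels Literature.Probability.RandomPlanarGeometry.SAW

namespace Summit.CriticalPhenomena.SAWScalingLimit.Theorems.InteriorFlattening.Liouville

namespace Promotion

/-- **The transfer statement is the Liouville uniqueness under (K).** `NoFoldBound → InteriorFlattening`
(route vocabulary: the rank-2 and rank-3 cruxes of `SAWDevelopingMap`) holds iff, under `NoFoldBound`, all
lattice-scale local limits of `M(O)`-normalised DCS observables at infinitely deep vertices coincide. -/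
theorem transfer_iff_subsingleton :
    (Summit.CriticalPhenomena.SAWScalingLimit.Theses.SAWDevelopingMap.NoFoldBound →
        Summit.CriticalPhenomena.SAWScalingLimit.Theses.SAWDevelopingMap.InteriorFlattening) ↔
      (Summit.CriticalPhenomena.SAWScalingLimit.Theses.SAWDevelopingMap.NoFoldBound → LocalLimits.Subsingleton) :=
  forall_congr' fun hK => interiorFlattening_iff_subsingleton_of_noFoldBound hK

/-- **S5\* ⟺ the conditional crux.** The registered top-layer stub `stub_localLimitsUnique` of the line (its exact
signature on the left) is equivalent to `BulkNoFold → InteriorFlattening`: given SOME eventual no-fold bound, (M). -/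
theorem localLimitsUnique_iff_conditional :
    (∀ k R₀ : ℝ, 0 ≤ k → k < 1 → RatioAtDepth R₀ k → LocalLimits.Subsingleton) ↔
      ((∃ k R₀ : ℝ, 0 ≤ k ∧ k < 1 ∧ RatioAtDepth R₀ k) →
        Summit.CriticalPhenomena.SAWScalingLimit.Theses.SAWDevelopingMap.InteriorFlattening) := by
  constructor
  · rintro h ⟨k, R₀, hk0, hk1, hR⟩
    exact interiorFlattening_of_bulkNoFold_of_subsingleton ⟨k, R₀, hk0, hk1, hR⟩ (h k R₀ hk0 hk1 hR)
  · intro h k R₀ hk0 hk1 hR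
    exact localLimits_subsingleton_of_interiorFlattening (h ⟨k, R₀, hk0, hk1, hR⟩)

/-- **S5\* ⟹ transfer**: the registered stub gives `NoFoldBound → InteriorFlattening` ((K) supplies the no-fold
bound with `R₀ = 0`, `k ↦ max k 0`). -/
theorem transfer_of_localLimitsUnique
    (h : ∀ k R₀ : ℝ, 0 ≤ k → k < 1 → RatioAtDepth R₀ k → LocalLimits.Subsingleton) :
    Summit.CriticalPhenomena.SAWScalingLimit.Theses.SAWDevelopingMap.NoFoldBound →
      Summit.CriticalPhenomena.SAWScalingLimit.Theses.SAWDevelopingMap.InteriorFlattening := fun hK =>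
  localLimitsUnique_iff_conditional.1 h (BulkNoFold.bulkNoFold_of_noFoldBound hK)

/-- **S1 read back in route vocabulary** (definitional): the line's `BulkNoFold`
(`∃ k R₀, 0 ≤ k ∧ k < 1 ∧ RatioAtDepth R₀ k`) is, letter by letter, the crux's inequality with a contraction
factor `k < 1` in place of `ε` at SOME depth `R₀` — `NoFoldBound` restricted to `R₀`-deep vertices. -/
theorem bulkNoFold_iff_routeVocabulary :
    (∃ k R₀ : ℝ, 0 ≤ k ∧ k < 1 ∧ RatioAtDepth R₀ k) ↔
      ∃ k R₀ : ℝ, 0 ≤ k ∧ k < 1 ∧ ∀ (Λ : Finset HexVertex), hexDomainSimplyConnected Λ →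
        ∀ a ∈ hexDomainBoundary Λ, ∀ v ∈ Λ,
          (∀ w : HexVertex, dist (hexCenter w) (hexCenter v) ≤ R₀ → w ∈ Λ) →
            ∀ w₀ w₁ w₂ : HexVertex, hexGraph.Adj v w₀ → hexGraph.Adj v w₁ → hexGraph.Adj v w₂ →
              w₀ ≠ w₁ → w₁ ≠ w₂ → w₀ ≠ w₂ →
                let F : Sym2 HexVertex → ℂ := hexParafermionicObservable Λ a hexCriticalFugacity (5 / 8)
                let ω : ℂ := Complex.exp (2 * Real.pi * Complex.I / 3)
                ‖F s(v, w₀) + ω * F s(v, w₁) + ω ^ 2 * F s(v, w₂)‖ ≤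
                  k * ‖F s(v, w₀) + F s(v, w₁) + F s(v, w₂)‖ :=
  Iff.rfl

/-- **S5\* in route vocabulary** (the pasteable signature): the registered stub `stub_localLimitsUnique` holds iff
an eventual no-fold bound — some `k < 1` bounding `‖F₀ + ωF₁ + ω²F₂‖ / ‖F₀ + F₁ + F₂‖` at every `R₀`-deep vertex of
every simply connected domain with a boundary root, in every frame — implies `InteriorFlattening`. Both sides of the
implication on the right are stated over `hexParafermionicObservable`, `hexDomainSimplyConnected`,
`hexDomainBoundary`, `hexCenter`, `hexGraph` only. -/
theorem localLimitsUnique_iff_routeVocabulary :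
    (∀ k R₀ : ℝ, 0 ≤ k → k < 1 → RatioAtDepth R₀ k → LocalLimits.Subsingleton) ↔
      ((∃ k R₀ : ℝ, 0 ≤ k ∧ k < 1 ∧ ∀ (Λ : Finset HexVertex), hexDomainSimplyConnected Λ →
        ∀ a ∈ hexDomainBoundary Λ, ∀ v ∈ Λ,
          (∀ w : HexVertex, dist (hexCenter w) (hexCenter v) ≤ R₀ → w ∈ Λ) →
            ∀ w₀ w₁ w₂ : HexVertex, hexGraph.Adj v w₀ → hexGraph.Adj v w₁ → hexGraph.Adj v w₂ →
              w₀ ≠ w₁ → w₁ ≠ w₂ → w₀ ≠ w₂ →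
                let F : Sym2 HexVertex → ℂ := hexParafermionicObservable Λ a hexCriticalFugacity (5 / 8)
                let ω : ℂ := Complex.exp (2 * Real.pi * Complex.I / 3)
                ‖F s(v, w₀) + ω * F s(v, w₁) + ω ^ 2 * F s(v, w₂)‖ ≤
                  k * ‖F s(v, w₀) + F s(v, w₁) + F s(v, w₂)‖) →
        Summit.CriticalPhenomena.SAWScalingLimit.Theses.SAWDevelopingMap.InteriorFlattening) :=
  localLimitsUnique_iff_conditional.trans (imp_congr_left bulkNoFold_iff_routeVocabulary)

end Promotion

end Summit.CriticalPhenomena.SAWScalingLimit.Theorems.InteriorFlattening.Liouville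

end
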